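import Literature.NumberTheory.ComplexMultiplication.CMOrderWeakEquivalenceSingularPrimes
import HarnessLib

/-!
# `𝔭`-equivalence read on the colon ideals: MARSEGLIA 2025 PROP. 3.2 (3) ⟺ (4) and its closing formulas —
# `1 ∈ (I:J)(J:I) + 𝔭 ⟺ ((I:J)(J:I))_𝔭 = (I:I)_𝔭`, and `I_𝔭 = αJ_𝔭 ⟹ (I:I)_𝔭 = (J:J)_𝔭`,
# `(I:J)_𝔭 = α(J:J)_𝔭`, `(J:I)_𝔭 = α⁻¹(J:J)_𝔭`

Family `hodge`, lane `lit-hodgefound` (Track 2 foundations library; seat p15, row g26-#6), topic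
`Literature/NumberTheory/ComplexMultiplication`, namespaces `Literature.NumberTheory.ComplexMultiplication.NumberRing`
(any domain `R` with fraction field `K`, noetherian where colon ideals are localised) and `…EndOrder` (§3: the order
`𝔯 = endOrder ρ`).  THEOREMS ONLY: no definition, no instance, no named fact (net Literature debt `0`).
Conventions as in `CMOrderWeakEquivalenceLocalIsomorphism` / `CMOrderWeakEquivalenceSingularPrimes` (g26-#3/#4):
`R_𝔭 = Localization.subalgebra.ofField K 𝔭.primeCompl _`, `N_𝔭 = span R_𝔭 ↑N`, `(I:J) = I / J` on
`FractionalIdeal R⁰ K`, `(I:J)_𝔭 = (I_𝔭:J_𝔭)` (`NumberRing.span_coe_div`).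

## Source, VERBATIM

S. Marseglia, *Local isomorphism classes of fractional ideals of orders in étale algebras*, J. Algebra 673 (2025)
77–102 [Marseglia2025LocalIsomorphism] (arXiv:2311.18571, held `paper:arxiv-2311.18571`, chunk p0006):
"Proposition 3.2. Let `I` and `J` be two fractional `R`-ideals, and let `𝔭` be a maximal ideal of `R`. Then the
following statements are equivalent: (1) `I` and `J` are `𝔭`-equivalent. (2) There exists a non-zero divisor
`α ∈ (I:J)_𝔭` such that `I_𝔭 = αJ_𝔭`. (3) `(I:J)_𝔭(J:I)_𝔭 = (I:I)_𝔭`. (4) `1 ∈ (I:J)(J:I) + 𝔭`.  If any of the above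
holds, then we have `(I:I)_𝔭 = (J:J)_𝔭`, `(I:J)_𝔭 = α(I:I)_𝔭` and `(J:I)_𝔭 = (1/α)(I:I)_𝔭`, with `α` as in (2).
Proof. … It is clear that (2) implies (3). … In the rest of the proof we will use the notation `N = (I:J)(J:I)`. Now
assume (3), and put `L = (N + 𝔭) ∩ R`. We will show that the inclusion `L ⊆ R` is everywhere locally an equality …
So, `L = R`, which implies `1 ∈ N + 𝔭`, that is, (4) holds. Conversely, assume (4). Then `(I:I) = N + 𝔭(I:I)`. …
Nakayama's lemma implies that `M_𝔭 = 0`, that is, that `N_𝔭 = (I:I)_𝔭`, which is precisely (3). The final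
statements are all immediate consequences of (2)."

## What is formalised

* §1 (any domain) submodule colon bookkeeping over the local ring `A = R_𝔭 ⊆ K`: `mem_span_singleton_mul_iff`
  (`y ∈ x·M ⟺ x⁻¹y ∈ M`), **`span_singleton_mul_div`** (`(xM : N) = x(M:N)`), **`div_span_singleton_mul`**
  (`(M : xN) = x⁻¹(M:N)`), `span_singleton_mul_div_span_singleton_mul` (`(xM : xN) = (M:N)`), and
  `mul_mem_span_coe_of_mem_div_self` (`N_𝔭` is an `(I:I)`-module when `(I:I)N ⊆ N`).
* §2 (noetherian domain) **`NumberRing.span_coe_div_mul_div_eq_iff_one_mem_span_coe`** (Prop. 3.2 (3) ⟺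
  «`1 ∈ N_𝔭`», with no Nakayama: `N` is an `(I:I)`-module), **`span_coe_div_mul_div_eq_iff_one_mem_add_coeIdeal`**
  (Prop. 3.2 (3) ⟺ (4)); the closing formulas **`span_coe_div_self_eq_of_span_coe_eq`** (`(I:I)_𝔭 = (J:J)_𝔭`),
  **`span_coe_div_eq_span_singleton_mul_of_span_coe_eq`** (`(I:J)_𝔭 = α(J:J)_𝔭`),
  **`span_coe_div_eq_span_singleton_inv_mul_of_span_coe_eq`** (`(J:I)_𝔭 = α⁻¹(J:J)_𝔭`), and
  `span_coe_div_mul_div_eq_of_span_coe_eq` (Prop. 3.2 (2) ⟹ (3)).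
* §3 the same packaged for `𝔯 = endOrder ρ` (`EndOrder.span_coe_div_mul_div_eq_iff_one_mem_add_coeIdeal`).
-/

open scoped nonZeroDivisors NumberField
open Module FractionalIdeal NumberField

namespace Literature.NumberTheory.ComplexMultiplication

namespace NumberRing

/-! ## §1 Colon bookkeeping for submodules of `K` over a subalgebra `A ⊆ K` -/

section Bookkeeping

variable {R : Type*} [CommRing R] {K : Type*} [Field K] [Algebra R K]

/-- `y ∈ x·M ⟺ x⁻¹y ∈ M` for an `A`-submodule `M ⊆ K` and `x ∈ K^*` (plumbing for «`(I:J)_𝔭 = (xJ_𝔭:J_𝔭) =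
x(J_𝔭:J_𝔭)`»). [cite: Marseglia2019, §4, proof of Prop. 4.1 ((1) ⟹ (2)), p. 8] -/
theorem mem_span_singleton_mul_iff (A : Subalgebra R K) {x : K} (hx : x ≠ 0) (M : Submodule A K) (y : K) :
    y ∈ Submodule.span A {x} * M ↔ x⁻¹ * y ∈ M := by
  constructor
  · intro hy
    refine Submodule.mul_induction_on hy (fun a ha m hm ↦ ?_) fun v w hv hw ↦ by
      rw [mul_add]; exact M.add_mem hv hw
    obtain ⟨t, rfl⟩ := Submodule.mem_span_singleton.1 ha
    rw [Subalgebra.smul_def, smul_eq_mul, show x⁻¹ * ((t : K) * x * m) = (t : K) * (x⁻¹ * x) * m by ring,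
      inv_mul_cancel₀ hx, mul_one, ← smul_eq_mul, ← Subalgebra.smul_def]
    exact M.smul_mem t hm
  · intro hy
    rw [show y = x * (x⁻¹ * y) by rw [← mul_assoc, mul_inv_cancel₀ hx, one_mul]]
    exact Submodule.mul_mem_mul (Submodule.mem_span_singleton_self x) hy

/-- **`(xM : N) = x·(M : N)`** for `A`-submodules of `K`, `x ∈ K^*`. [cite: Marseglia2019, §4, proof of Prop. 4.1
(«`(I_𝔭:J_𝔭) = (xJ_𝔭:J_𝔭) = x(J_𝔭:J_𝔭)`»), p. 8] [cite: Marseglia2025LocalIsomorphism, §3 Prop. 3.2 (closing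
formulas), p. 6] -/
theorem span_singleton_mul_div (A : Subalgebra R K) {x : K} (hx : x ≠ 0) (M N : Submodule A K) :
    (Submodule.span A {x} * M) / N = Submodule.span A {x} * (M / N) := by
  ext y
  rw [mem_span_singleton_mul_iff A hx, Submodule.mem_div_iff_forall_mul_mem, Submodule.mem_div_iff_forall_mul_mem]
  refine ⟨fun h n hn ↦ ?_, fun h n hn ↦ ?_⟩
  · rw [mul_assoc]
    exact (mem_span_singleton_mul_iff A hx M _).1 (h n hn)
  · rw [mem_span_singleton_mul_iff A hx, ← mul_assoc]
    exact h n hn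

/-- **`(M : xN) = x⁻¹·(M : N)`** for `A`-submodules of `K`, `x ∈ K^*`. [cite: Marseglia2019, §4, proof of Prop. 4.1
(«`(J_𝔭:I_𝔭) = (J_𝔭:xJ_𝔭) = (1/x)(J_𝔭:J_𝔭)`»), p. 8] [cite: Marseglia2025LocalIsomorphism, §3 Prop. 3.2 (closing
formulas), p. 6] -/
theorem div_span_singleton_mul (A : Subalgebra R K) {x : K} (hx : x ≠ 0) (M N : Submodule A K) :
    M / (Submodule.span A {x} * N) = Submodule.span A {x⁻¹} * (M / N) := by
  ext y
  rw [mem_span_singleton_mul_iff A (inv_ne_zero hx), inv_inv, Submodule.mem_div_iff_forall_mul_mem,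
    Submodule.mem_div_iff_forall_mul_mem]
  refine ⟨fun h n hn ↦ ?_, fun h v hv ↦ ?_⟩
  · rw [show x * y * n = y * (x * n) by ring]
    exact h _ (Submodule.mul_mem_mul (Submodule.mem_span_singleton_self x) hn)
  · have hv' := (mem_span_singleton_mul_iff A hx N v).1 hv
    have := h _ hv'
    rwa [show x * y * (x⁻¹ * v) = (x * x⁻¹) * (y * v) by ring, mul_inv_cancel₀ hx, one_mul] at this

/-- **`(xM : xN) = (M : N)`** (`x ∈ K^*`). [cite: Marseglia2025LocalIsomorphism, §3 Prop. 3.2 («`(I:I)_𝔭 = (J:J)_𝔭`»),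
p. 6] -/
theorem span_singleton_mul_div_span_singleton_mul (A : Subalgebra R K) {x : K} (hx : x ≠ 0) (M N : Submodule A K) :
    (Submodule.span A {x} * M) / (Submodule.span A {x} * N) = M / N := by
  rw [span_singleton_mul_div A hx, div_span_singleton_mul A hx, ← mul_assoc, Submodule.span_mul_span,
    Set.singleton_mul_singleton, mul_inv_cancel₀ hx, ← Submodule.one_eq_span, one_mul]

end Bookkeeping

/-! ## §2 Proposition 3.2 (3) ⟺ (4) and the closing formulas -/

section LocalColon

variable {R : Type*} [CommRing R] [IsDomain R] {K : Type*} [Field K] [Algebra R K] [IsFractionRing R K]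

omit [IsDomain R] [IsFractionRing R K] in
/-- **`N_𝔭` is an `S`-module when `SN ⊆ N`**: for fractional ideals `S`, `N` with `S * N ≤ N`, the local component
`N_𝔭 = span R_𝔭 ↑N` is stable under multiplication by the elements of `S` (plumbing for «`(I:J)(J:I)` has a structure
of `(I:I)`-module»). [cite: Marseglia2019, §4 Prop. 4.1 (proof of (2) ⟹ (3)), p. 8] -/
theorem mul_mem_span_coe_of_mul_le (A : Subalgebra R K) {S N : FractionalIdeal R⁰ K} (hSN : S * N ≤ N) {s : K}
    (hs : s ∈ S) {y : K} (hy : y ∈ Submodule.span A (N : Set K)) : s * y ∈ Submodule.span A (N : Set K) := by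
  induction hy using Submodule.span_induction with
  | mem n hn => exact Submodule.subset_span (hSN (mul_mem_mul hs hn))
  | zero => rw [mul_zero]; exact Submodule.zero_mem _
  | add v w _ _ hv hw => rw [mul_add]; exact Submodule.add_mem _ hv hw
  | smul a v _ hv => rw [mul_smul_comm]; exact Submodule.smul_mem _ a hv

/-- **PROPOSITION 3.2 (3) ⟺ «`1 ∈ N_𝔭`»: `((I:J)(J:I))_𝔭 = (I:I)_𝔭 ⟺ 1 ∈ ((I:J)(J:I))_𝔭`** (`N = (I:J)(J:I)` is an
`(I:I)`-module with `N ⊆ (I:I)`, so `1 ∈ N_𝔭` forces `(I:I) ⊆ N_𝔭`; this replaces the Nakayama step of the printed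
proof). [cite: Marseglia2025LocalIsomorphism, §3 Prop. 3.2 ((3) ⟺ (4), proof), p. 6] [cite: Marseglia2019, §4
Prop. 4.1 («`(I:J)(J:I) ⊆ (I:I)` … has a structure of `(I:I)`-module»), p. 8] -/
theorem span_coe_div_mul_div_eq_iff_one_mem_span_coe {I J : FractionalIdeal R⁰ K} (hI : I ≠ 0) (hJ : J ≠ 0)
    (𝔭 : Ideal R) [𝔭.IsPrime] :
    Submodule.span (Localization.subalgebra.ofField K 𝔭.primeCompl 𝔭.primeCompl_le_nonZeroDivisors)
        ((I / J * (J / I) : FractionalIdeal R⁰ K) : Set K) =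
      Submodule.span (Localization.subalgebra.ofField K 𝔭.primeCompl 𝔭.primeCompl_le_nonZeroDivisors)
        ((I / I : FractionalIdeal R⁰ K) : Set K) ↔
    (1 : K) ∈ Submodule.span (Localization.subalgebra.ofField K 𝔭.primeCompl 𝔭.primeCompl_le_nonZeroDivisors)
        ((I / J * (J / I) : FractionalIdeal R⁰ K) : Set K) := by
  set A := Localization.subalgebra.ofField K 𝔭.primeCompl 𝔭.primeCompl_le_nonZeroDivisors with hA
  -- `N ⊆ S = (I:I)` and `SN ⊆ N`
  have hNS : I / J * (J / I) ≤ I / I := by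
    refine (le_div_iff_mul_le hI).2 ?_
    calc I / J * (J / I) * I = I / J * (J / I * I) := mul_assoc _ _ _
      _ ≤ I / J * J := mul_le_mul' le_rfl ((le_div_iff_mul_le hI).1 le_rfl)
      _ ≤ I := (le_div_iff_mul_le hJ).1 le_rfl
  have hSN : I / I * (I / J * (J / I)) ≤ I / J * (J / I) := by
    rw [← mul_assoc]
    refine mul_le_mul' ((le_div_iff_mul_le hJ).2 ?_) le_rfl
    calc I / I * (I / J) * J = I / I * (I / J * J) := mul_assoc _ _ _
      _ ≤ I / I * I := mul_le_mul' le_rfl ((le_div_iff_mul_le hJ).1 le_rfl)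
      _ ≤ I := (le_div_iff_mul_le hI).1 le_rfl
  constructor
  · intro h
    rw [h]
    exact Submodule.subset_span ((mem_div_iff_of_ne_zero hI).2 fun y hy ↦ by rwa [one_mul])
  · intro h1
    refine le_antisymm (Submodule.span_mono (fun y hy ↦ hNS hy)) (Submodule.span_le.2 fun s hs ↦ ?_)
    rw [SetLike.mem_coe, ← mul_one s]
    exact mul_mem_span_coe_of_mul_le A hSN hs h1

/-- **PROPOSITION 3.2 (3) ⟺ (4): `((I:J)(J:I))_𝔭 = (I:I)_𝔭 ⟺ 1 ∈ (I:J)(J:I) + 𝔭`** for a maximal ideal `𝔭` and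
nonzero fractional ideals of a domain. [cite: Marseglia2025LocalIsomorphism, §3 Prop. 3.2 ((3) ⟺ (4)), p. 6] -/
theorem span_coe_div_mul_div_eq_iff_one_mem_add_coeIdeal {I J : FractionalIdeal R⁰ K} (hI : I ≠ 0) (hJ : J ≠ 0)
    (𝔭 : Ideal R) [𝔭.IsMaximal] :
    Submodule.span (Localization.subalgebra.ofField K 𝔭.primeCompl 𝔭.primeCompl_le_nonZeroDivisors)
        ((I / J * (J / I) : FractionalIdeal R⁰ K) : Set K) =
      Submodule.span (Localization.subalgebra.ofField K 𝔭.primeCompl 𝔭.primeCompl_le_nonZeroDivisors)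
        ((I / I : FractionalIdeal R⁰ K) : Set K) ↔
    (1 : K) ∈ I / J * (J / I) + (𝔭 : FractionalIdeal R⁰ K) := by
  rw [span_coe_div_mul_div_eq_iff_one_mem_span_coe hI hJ, one_mem_span_coe_iff_one_mem_add_coeIdeal]

/-- **PROPOSITION 3.2 (2) ⟹ (3): `I_𝔭 = x·J_𝔭 ⟹ ((I:J)(J:I))_𝔭 = (I:I)_𝔭`** («It is clear that (2) implies (3)»;
noetherian `R`). [cite: Marseglia2025LocalIsomorphism, §3 Prop. 3.2 ((2) ⟹ (3)), p. 6] -/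
theorem span_coe_div_mul_div_eq_of_span_coe_eq [IsNoetherianRing R] {I J : FractionalIdeal R⁰ K} (hI : I ≠ 0)
    (hJ : J ≠ 0) (𝔭 : Ideal R) [𝔭.IsPrime] {x : K}
    (hx : Submodule.span (Localization.subalgebra.ofField K 𝔭.primeCompl 𝔭.primeCompl_le_nonZeroDivisors)
        (I : Set K) =
      Submodule.span (Localization.subalgebra.ofField K 𝔭.primeCompl 𝔭.primeCompl_le_nonZeroDivisors) {x} *
        Submodule.span (Localization.subalgebra.ofField K 𝔭.primeCompl 𝔭.primeCompl_le_nonZeroDivisors)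
          (J : Set K)) :
    Submodule.span (Localization.subalgebra.ofField K 𝔭.primeCompl 𝔭.primeCompl_le_nonZeroDivisors)
        ((I / J * (J / I) : FractionalIdeal R⁰ K) : Set K) =
      Submodule.span (Localization.subalgebra.ofField K 𝔭.primeCompl 𝔭.primeCompl_le_nonZeroDivisors)
        ((I / I : FractionalIdeal R⁰ K) : Set K) :=
  (span_coe_div_mul_div_eq_iff_one_mem_span_coe hI hJ 𝔭).2 (one_mem_span_coe_div_mul_div_of_span_coe_eq hI hJ 𝔭 hx)

/-- `x ≠ 0` in `I_𝔭 = x·J_𝔭` when `I ≠ 0` (plumbing: `I_𝔭` contains a nonzero element of `I`).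
[cite: Marseglia2025LocalIsomorphism, §3 Prop. 3.2 (2) («non-zero divisor `α`»), p. 6] -/
theorem ne_zero_of_span_coe_eq_span_singleton_mul {I J : FractionalIdeal R⁰ K} (hI : I ≠ 0) (𝔭 : Ideal R)
    [𝔭.IsPrime] {x : K}
    (hx : Submodule.span (Localization.subalgebra.ofField K 𝔭.primeCompl 𝔭.primeCompl_le_nonZeroDivisors)
        (I : Set K) =
      Submodule.span (Localization.subalgebra.ofField K 𝔭.primeCompl 𝔭.primeCompl_le_nonZeroDivisors) {x} *
        Submodule.span (Localization.subalgebra.ofField K 𝔭.primeCompl 𝔭.primeCompl_le_nonZeroDivisors)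
          (J : Set K)) : x ≠ 0 := by
  rintro rfl
  obtain ⟨a, ha0, haI⟩ := exists_ne_zero_mem_isInteger hI
  have ha : algebraMap R K a ∈ Submodule.span
      (Localization.subalgebra.ofField K 𝔭.primeCompl 𝔭.primeCompl_le_nonZeroDivisors) (I : Set K) :=
    Submodule.subset_span haI
  rw [hx, Submodule.span_singleton_eq_bot.2 rfl, Submodule.bot_mul] at ha
  exact ha0 (IsFractionRing.injective R K (((Submodule.mem_bot _).1 ha).trans (map_zero _).symm))

/-- **PROPOSITION 3.2, closing formula `(I:I)_𝔭 = (J:J)_𝔭`** for `𝔭`-equivalent `I`, `J` (`I_𝔭 = xJ_𝔭`; noetherian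
`R`). [cite: Marseglia2025LocalIsomorphism, §3 Prop. 3.2 («`(I:I)_𝔭 = (J:J)_𝔭`»), p. 6] -/
theorem span_coe_div_self_eq_of_span_coe_eq [IsNoetherianRing R] {I J : FractionalIdeal R⁰ K} (hI : I ≠ 0)
    (hJ : J ≠ 0) (𝔭 : Ideal R) [𝔭.IsPrime] {x : K}
    (hx : Submodule.span (Localization.subalgebra.ofField K 𝔭.primeCompl 𝔭.primeCompl_le_nonZeroDivisors)
        (I : Set K) =
      Submodule.span (Localization.subalgebra.ofField K 𝔭.primeCompl 𝔭.primeCompl_le_nonZeroDivisors) {x} *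
        Submodule.span (Localization.subalgebra.ofField K 𝔭.primeCompl 𝔭.primeCompl_le_nonZeroDivisors)
          (J : Set K)) :
    Submodule.span (Localization.subalgebra.ofField K 𝔭.primeCompl 𝔭.primeCompl_le_nonZeroDivisors)
        ((I / I : FractionalIdeal R⁰ K) : Set K) =
      Submodule.span (Localization.subalgebra.ofField K 𝔭.primeCompl 𝔭.primeCompl_le_nonZeroDivisors)
        ((J / J : FractionalIdeal R⁰ K) : Set K) := by
  rw [span_coe_div hI, span_coe_div hJ, hx,
    span_singleton_mul_div_span_singleton_mul _ (ne_zero_of_span_coe_eq_span_singleton_mul hI 𝔭 hx)]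

/-- **PROPOSITION 3.2, closing formula `(I:J)_𝔭 = x·(J:J)_𝔭`** (`I_𝔭 = xJ_𝔭`, `I`, `J ≠ 0`; noetherian
`R`). [cite: Marseglia2025LocalIsomorphism, §3 Prop. 3.2 («`(I:J)_𝔭 = α(I:I)_𝔭`»), p. 6] [cite: Marseglia2019, §4, proof
of Prop. 4.1 («`(I_𝔭:J_𝔭) = (xJ_𝔭:J_𝔭) = x(J_𝔭:J_𝔭)`»), p. 8] -/
theorem span_coe_div_eq_span_singleton_mul_of_span_coe_eq [IsNoetherianRing R] {I J : FractionalIdeal R⁰ K}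
    (hI : I ≠ 0) (hJ : J ≠ 0) (𝔭 : Ideal R) [𝔭.IsPrime] {x : K}
    (hx : Submodule.span (Localization.subalgebra.ofField K 𝔭.primeCompl 𝔭.primeCompl_le_nonZeroDivisors)
        (I : Set K) =
      Submodule.span (Localization.subalgebra.ofField K 𝔭.primeCompl 𝔭.primeCompl_le_nonZeroDivisors) {x} *
        Submodule.span (Localization.subalgebra.ofField K 𝔭.primeCompl 𝔭.primeCompl_le_nonZeroDivisors)
          (J : Set K)) :
    Submodule.span (Localization.subalgebra.ofField K 𝔭.primeCompl 𝔭.primeCompl_le_nonZeroDivisors)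
        ((I / J : FractionalIdeal R⁰ K) : Set K) =
      Submodule.span (Localization.subalgebra.ofField K 𝔭.primeCompl 𝔭.primeCompl_le_nonZeroDivisors) {x} *
        Submodule.span (Localization.subalgebra.ofField K 𝔭.primeCompl 𝔭.primeCompl_le_nonZeroDivisors)
          ((J / J : FractionalIdeal R⁰ K) : Set K) := by
  rw [span_coe_div hJ, span_coe_div hJ, hx, span_singleton_mul_div _ (ne_zero_of_span_coe_eq_span_singleton_mul hI 𝔭 hx)]

/-- **PROPOSITION 3.2, closing formula `(J:I)_𝔭 = x⁻¹·(J:J)_𝔭`** (`I_𝔭 = xJ_𝔭`, `I`, `J ≠ 0`; noetherian `R`).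
[cite: Marseglia2025LocalIsomorphism, §3 Prop. 3.2 («`(J:I)_𝔭 = (1/α)(I:I)_𝔭`»), p. 6] [cite: Marseglia2019, §4,
proof of Prop. 4.1 («`(J_𝔭:I_𝔭) = (J_𝔭:xJ_𝔭) = (1/x)(J_𝔭:J_𝔭)`»), p. 8] -/
theorem span_coe_div_eq_span_singleton_inv_mul_of_span_coe_eq [IsNoetherianRing R] {I J : FractionalIdeal R⁰ K}
    (hI : I ≠ 0) (hJ : J ≠ 0) (𝔭 : Ideal R) [𝔭.IsPrime] {x : K}
    (hx : Submodule.span (Localization.subalgebra.ofField K 𝔭.primeCompl 𝔭.primeCompl_le_nonZeroDivisors)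
        (I : Set K) =
      Submodule.span (Localization.subalgebra.ofField K 𝔭.primeCompl 𝔭.primeCompl_le_nonZeroDivisors) {x} *
        Submodule.span (Localization.subalgebra.ofField K 𝔭.primeCompl 𝔭.primeCompl_le_nonZeroDivisors)
          (J : Set K)) :
    Submodule.span (Localization.subalgebra.ofField K 𝔭.primeCompl 𝔭.primeCompl_le_nonZeroDivisors)
        ((J / I : FractionalIdeal R⁰ K) : Set K) =
      Submodule.span (Localization.subalgebra.ofField K 𝔭.primeCompl 𝔭.primeCompl_le_nonZeroDivisors) {x⁻¹} *
        Submodule.span (Localization.subalgebra.ofField K 𝔭.primeCompl 𝔭.primeCompl_le_nonZeroDivisors)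
          ((J / J : FractionalIdeal R⁰ K) : Set K) := by
  rw [span_coe_div hI, span_coe_div hJ, hx,
    div_span_singleton_mul _ (ne_zero_of_span_coe_eq_span_singleton_mul hI 𝔭 hx)]

end LocalColon

end NumberRing

/-! ## §3 The order `𝔯 = endOrder ρ` -/

namespace EndOrder

variable {K : Type} [Field K] [NumberField K]
variable {ι : Type} [Fintype ι] [DecidableEq ι] [Nonempty ι] {ρ : K →ₐ[ℚ] Matrix ι ι ℚ}
variable [IsFractionRing (endOrder ρ) K]

omit [Nonempty ι] in
/-- **PROPOSITION 3.2 (3) ⟺ (4) for the order `𝔯 = endOrder ρ`: `((I:J)(J:I))_𝔭 = (I:I)_𝔭 ⟺ 1 ∈ (I:J)(J:I) + 𝔭`**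
(`𝔭` maximal, `I`, `J ≠ 0`). [cite: Marseglia2025LocalIsomorphism, §3 Prop. 3.2 ((3) ⟺ (4)), p. 6] -/
theorem span_coe_div_mul_div_eq_iff_one_mem_add_coeIdeal {I J : FractionalIdeal (endOrder ρ)⁰ K} (hI : I ≠ 0)
    (hJ : J ≠ 0) (𝔭 : Ideal (endOrder ρ)) [𝔭.IsMaximal] :
    Submodule.span (Localization.subalgebra.ofField K 𝔭.primeCompl 𝔭.primeCompl_le_nonZeroDivisors)
        ((I / J * (J / I) : FractionalIdeal (endOrder ρ)⁰ K) : Set K) =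
      Submodule.span (Localization.subalgebra.ofField K 𝔭.primeCompl 𝔭.primeCompl_le_nonZeroDivisors)
        ((I / I : FractionalIdeal (endOrder ρ)⁰ K) : Set K) ↔
    (1 : K) ∈ I / J * (J / I) + (𝔭 : FractionalIdeal (endOrder ρ)⁰ K) :=
  NumberRing.span_coe_div_mul_div_eq_iff_one_mem_add_coeIdeal hI hJ 𝔭

/-- **PROPOSITION 3.2 for `𝔯 = endOrder ρ`, (2) ⟹ (3) with the closing formulas**: `I_𝔭 = xJ_𝔭` ⟹
`((I:J)(J:I))_𝔭 = (I:I)_𝔭 = (J:J)_𝔭`, `(I:J)_𝔭 = x(J:J)_𝔭`, `(J:I)_𝔭 = x⁻¹(J:J)_𝔭`.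
[cite: Marseglia2025LocalIsomorphism, §3 Prop. 3.2 ((2) ⟹ (3) and the closing formulas), p. 6] -/
theorem span_coe_div_eq_of_span_coe_eq {I J : FractionalIdeal (endOrder ρ)⁰ K} (hI : I ≠ 0) (hJ : J ≠ 0)
    (𝔭 : Ideal (endOrder ρ)) [𝔭.IsPrime] {x : K}
    (hx : Submodule.span (Localization.subalgebra.ofField K 𝔭.primeCompl 𝔭.primeCompl_le_nonZeroDivisors)
        (I : Set K) =
      Submodule.span (Localization.subalgebra.ofField K 𝔭.primeCompl 𝔭.primeCompl_le_nonZeroDivisors) {x} *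
        Submodule.span (Localization.subalgebra.ofField K 𝔭.primeCompl 𝔭.primeCompl_le_nonZeroDivisors)
          (J : Set K)) :
    Submodule.span (Localization.subalgebra.ofField K 𝔭.primeCompl 𝔭.primeCompl_le_nonZeroDivisors)
          ((I / J * (J / I) : FractionalIdeal (endOrder ρ)⁰ K) : Set K) =
        Submodule.span (Localization.subalgebra.ofField K 𝔭.primeCompl 𝔭.primeCompl_le_nonZeroDivisors)
          ((I / I : FractionalIdeal (endOrder ρ)⁰ K) : Set K) ∧
      Submodule.span (Localization.subalgebra.ofField K 𝔭.primeCompl 𝔭.primeCompl_le_nonZeroDivisors)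
          ((I / I : FractionalIdeal (endOrder ρ)⁰ K) : Set K) =
        Submodule.span (Localization.subalgebra.ofField K 𝔭.primeCompl 𝔭.primeCompl_le_nonZeroDivisors)
          ((J / J : FractionalIdeal (endOrder ρ)⁰ K) : Set K) ∧
      Submodule.span (Localization.subalgebra.ofField K 𝔭.primeCompl 𝔭.primeCompl_le_nonZeroDivisors)
          ((I / J : FractionalIdeal (endOrder ρ)⁰ K) : Set K) =
        Submodule.span (Localization.subalgebra.ofField K 𝔭.primeCompl 𝔭.primeCompl_le_nonZeroDivisors) {x} *
          Submodule.span (Localization.subalgebra.ofField K 𝔭.primeCompl 𝔭.primeCompl_le_nonZeroDivisors)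
            ((J / J : FractionalIdeal (endOrder ρ)⁰ K) : Set K) ∧
      Submodule.span (Localization.subalgebra.ofField K 𝔭.primeCompl 𝔭.primeCompl_le_nonZeroDivisors)
          ((J / I : FractionalIdeal (endOrder ρ)⁰ K) : Set K) =
        Submodule.span (Localization.subalgebra.ofField K 𝔭.primeCompl 𝔭.primeCompl_le_nonZeroDivisors) {x⁻¹} *
          Submodule.span (Localization.subalgebra.ofField K 𝔭.primeCompl 𝔭.primeCompl_le_nonZeroDivisors)
            ((J / J : FractionalIdeal (endOrder ρ)⁰ K) : Set K) :=
  haveI := CMTypeLattice.isNoetherianRing_endOrder ρ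
  ⟨NumberRing.span_coe_div_mul_div_eq_of_span_coe_eq hI hJ 𝔭 hx,
    NumberRing.span_coe_div_self_eq_of_span_coe_eq hI hJ 𝔭 hx,
    NumberRing.span_coe_div_eq_span_singleton_mul_of_span_coe_eq hI hJ 𝔭 hx,
    NumberRing.span_coe_div_eq_span_singleton_inv_mul_of_span_coe_eq hI hJ 𝔭 hx⟩

end EndOrder

end Literature.NumberTheory.ComplexMultiplication
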